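import Mathlib.Algebra.BigOperators.Fin
import Literature.Algebra.Lie.ChevalleyEilenbergKugaAdjoint
import HarnessLib

/-!
# Horizontal cochains are determined by their values on `𝔭`-basis tuples —
crux HeckeEigenvalueField (stmt-Langlands-13632), line Sketch, stub REL-EXT

Statement.  Let `K ≤ L` be a Lie subalgebra (`𝔨 ≤ 𝔤`) and `x : ι → L` a finite family with
`L = K + span {x i}` (every `v ∈ L` is `k + ∑ᵢ cᵢ • xᵢ` with `k ∈ K`).  If two `K`-horizontal
`q`-cochains `f, g ∈ C^q(L; M)` (`i_y f = i_y g = 0` for `y ∈ K`) agree on all tuples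
`(x_{I 0}, …, x_{I (q-1)})`, `I : Fin q → ι`, then `f = g`
[cite: BorelWallach2000, I §1.2]: a relative cochain is a form on `Λ^q (𝔤/𝔨) = Λ^q 𝔭`.

Proof.  Put `h := f - g`, a `K`-horizontal cochain vanishing on every tuple `x ∘ I`; we show
`h = 0` by induction on the degree `q` (the argument of the tree's
`eq_zero_of_cochainForm_self_eq_zero`, without the scalar product).  In degree `0` the only
tuple is the empty one.  In degree `q + 1` every insertion `i_{x i} h` is again `K`-horizontal
(insertions anticommute, `ins_mem_horizontal`) and vanishes on the tuples `x ∘ J`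
(`(i_{x i} h)(x ∘ J) = h (x ∘ cons i J)`), hence vanishes by the induction hypothesis; the
insertions `i_k h`, `k ∈ K`, vanish by horizontality; so `i_z h = 0` for every
`z = k + ∑ᵢ cᵢ • xᵢ ∈ L`, and a `(q+1)`-cochain is determined by its insertions (`ext_ins`).

## References

* A. Borel, N. Wallach, *Continuous cohomology, discrete subgroups, and representations of
  reductive groups*, 2nd ed., Math. Surveys Monogr. 67 (2000), I §1.1–§1.2, II §2.4.
  [BorelWallach2000]
* C. Chevalley, S. Eilenberg, *Cohomology theory of Lie groups and Lie algebras*, Trans. Amer.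
  Math. Soc. 63 (1948) 85–124, §23, §28. [ChevalleyEilenberg1948]
-/

set_option linter.dupNamespace false -- project-wide: `Summit.Langlands.Langlands` is the mandated namespace

open Finset
open Literature.Algebra.Lie Literature.Algebra.Lie.ChevalleyEilenberg

namespace Summit.Langlands.Langlands.Theorems.HeckeEigenvalueField.Res

namespace RelExt

/-- Consing `x i` onto the tuple `x ∘ J` gives the tuple `x ∘ cons i J`. [folklore] -/
theorem vecCons_apply_tuple {ι L : Type*} (x : ι → L) (i : ι) {n : ℕ} (J : Fin n → ι) :
    Matrix.vecCons (x i) (fun j => x (J j)) = fun j => x ((Fin.cons i J : Fin (n + 1) → ι) j) := by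
  funext j
  refine Fin.cases ?_ (fun j => ?_) j
  · simp only [Matrix.cons_val_zero, Fin.cons_zero]
  · simp only [Matrix.cons_val_succ, Fin.cons_succ]

/-- **A horizontal cochain vanishing on basis tuples vanishes**: if `L = K + span {x i}`, a
`K`-horizontal `q`-cochain which is zero on every tuple `x ∘ I` is zero (induction on the degree:
the insertions of the `x i` vanish by the induction hypothesis, those of `K` by horizontality,
hence all insertions vanish). [cite: BorelWallach2000, I §1.2] -/
theorem eq_zero_of_horizontal_of_apply_tuple_eq_zero
    {R : Type*} [CommRing R] {L : Type*} [LieRing L] [LieAlgebra R L]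
    {M : Type*} [AddCommGroup M] [Module R M]
    (K : LieSubalgebra R L) {ι : Type*} [Fintype ι] (x : ι → L)
    (hL : ∀ v : L, ∃ (k : L) (c : ι → R), k ∈ K ∧ v = k + ∑ i, c i • x i) :
    ∀ (q : ℕ) {h : Cochain R L M q}, h ∈ horizontal (M := M) K q →
      (∀ I : Fin q → ι, h (fun i => x (I i)) = 0) → h = 0
  | 0, h, _, h0 => by
    refine AlternatingMap.ext fun v => ?_
    rw [AlternatingMap.zero_apply]
    exact (congrArg h (Subsingleton.elim v _)).trans (h0 fun i => i.elim0)
  | q + 1, h, hh, h0 => by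
    have hi : ∀ i, ins q (x i) h = 0 := fun i =>
      eq_zero_of_horizontal_of_apply_tuple_eq_zero K x hL q (ins_mem_horizontal K _ hh) fun J => by
        rw [ins_apply, vecCons_apply_tuple x i J]
        exact h0 _
    refine ext_ins fun z => ?_
    obtain ⟨k, c, hk, rfl⟩ := hL z
    rw [map_zero, ins_add, (mem_horizontal_succ_iff K q h).1 hh k hk, zero_add, ins_finset_sum]
    exact Finset.sum_eq_zero fun i _ => by rw [ins_smul, hi i, smul_zero]

end RelExt

/-- **Stub REL-EXT — horizontal cochains are determined by their values on `𝔭`-basis tuples**: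
if `L = 𝔨 + span {x i}` and two `𝔨`-horizontal `q`-cochains agree on all tuples `x ∘ I`, they are equal
(multilinear expansion of the arguments along `𝔨 ⊕ ⟨x⟩`; every term with an argument in `𝔨` dies).
[cite: BorelWallach2000, I §1.2] -/
theorem stub_eq_of_horizontal_of_basisTuple
    {R : Type} [CommRing R] {L : Type} [LieRing L] [LieAlgebra R L]
    {M : Type} [AddCommGroup M] [Module R M]
    (K : LieSubalgebra R L) {ι : Type} [Fintype ι] (x : ι → L)
    (hL : ∀ v : L, ∃ (k : L) (c : ι → R), k ∈ K ∧ v = k + ∑ i, c i • x i)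
    {q : ℕ} (f g : Cochain R L M q) (hf : f ∈ horizontal K q) (hg : g ∈ horizontal K q)
    (hfg : ∀ I : Fin q → ι, f (fun i => x (I i)) = g (fun i => x (I i))) : f = g := by
  rw [← sub_eq_zero]
  exact RelExt.eq_zero_of_horizontal_of_apply_tuple_eq_zero K x hL q (Submodule.sub_mem _ hf hg)
    fun I => by rw [AlternatingMap.sub_apply, hfg I, sub_self]

end Summit.Langlands.Langlands.Theorems.HeckeEigenvalueField.Res
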